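import Mathlib

/-!
# Decomposable 2-forms: «rank `≤ 2` ⇒ `β = ι a · ι b`» as a theorem (pub-hsemireg, S4-PUSH corner 2)

Kernel leg of seat s4-search-2 gen 17 (cell `pub-hsemireg`).  PURPOSE: the ONE framework word left in the
CLASS-DEAD theorems of the `E = ∅` units of the M2 cell — precision **S-N-2** of s4-ref g48 VERDICT V#7 on rows
N1 ∕ N2 ∕ N3 (`s4push/search-2/g16/PEN-NOTE-corner2-g16.md`): «the sentence "the leading digit of an `E = ∅` unit is
a 2-form of rank `≤ 2`, i.e. `β = ι a·ι b`" contains ONE framework word — an alternating form of rank `≤ 2` is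
decomposable; the kernel rows (`LemmaCFrameClassDead.lemmaC_classDead`, `DimZeroUnitsClassDead.classDead_c222234`,
`DimZeroUnitsClassDeadFive.classDead_c222225`) take `β = ι a ι b` as their hypothesis and do not prove the normal
form» — becomes a theorem here, in exactly the hypothesis shape of those rows
(`B = ι a · ι b + 2·X`, `X ∈ Submodule.span ℤ {ι p · ι q}`).

**Contents (Mathlib only; theorems only, no `def`).**
1. `decomposable_of_pluecker` — over a field, an array `A` satisfying all Plücker relations
   `A i j·A k l − A i k·A j l + A i l·A j k = 0` is `A i j = a i·b j − a j·b i` (pivot on a non-zero entry);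
   `pluecker_of_decomposable` — the converse identity (any commutative ring).
2. `det_eq_pfaffian_sq` — `det S = Pf(S)²` for an alternating `4 × 4` matrix; `pluecker_of_rank_le_two` — for an
   alternating matrix over a field, `Matrix.rank ≤ 2` ⇒ every `4 × 4` Pfaffian vanishes (the `4 × 4` submatrix on
   `i, j, k, l` has rank `≤ 2 < 4`, `Matrix.rank_submatrix_le` ∕ `Matrix.rank_of_isUnit`); hence
   `decomposable_of_rank_le_two`.
3. `exists_int_decomposable_mod_two` — Plücker modulo `2` ⇒ `c i j ≡ a i·b j − a j·b i (mod 2)` with INTEGER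
   vectors (apply 1. in `𝔽₂ = ZMod 2`, lift by `ZMod.val`).
4. In `ExteriorAlgebra ℤ M` for any finite family `x : n → M` (`n` a finite linear order; a basis of `ℤ¹²` in the
   application): `ι_mul_ι_sum` — `ι(Σ aᵢxᵢ)·ι(Σ bⱼxⱼ) = Σ_{i<j} (aᵢbⱼ − aⱼbᵢ)·ι xᵢ ι xⱼ`;
   `twoForm_eq_decomposable_add_two_mul` — coefficients decomposable modulo `2` ⇒ `B = ι a·ι b + 2·X`;
   `exists_coeff_of_mem_span` — every element of the `ℤ`-span of the 2-vectors has an ALTERNATING coefficient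
   array in a basis; and the two statements of S-N-2: `exists_eq_ι_mul_ι_add_two_mul` (Plücker form: the
   coefficient array of `B = Σ_{i<j} c i j·ι xᵢ ι xⱼ` satisfies the Plücker relations modulo `2` — for alternating
   `c` these are the `4 × 4` Pfaffians, the coefficients of the divided square, i.e. «`B̄^[2] = 0` over `𝔽₂`») and
   `exists_eq_ι_mul_ι_add_two_mul_of_rank_le_two` (rank form: the array read in `𝔽₂` is alternating of
   `Matrix.rank ≤ 2`) ⇒ `∃ a b X, X ∈ span ∧ B = ι a·ι b + 2·X`.

Scope ∕ honest framing: linear algebra of alternating forms (the rank-`2` case of the normal form of alternating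
matrices, over a field and modulo `2`), count-neutral; it turns the words «rank `≤ 2` ⇒ `β = ι a ι b`» of the cited
rows into a kernel fact and says nothing else — which 2-forms ARE the leading digits of which units (the census ∕
type assignment, CRITERION L as the registered necessary condition, the signature table) remain framework words of
`s4push/search-2/`; no object, no `σ` computation, no Hodge statement; nothing here bears on HC ∕ HC_CM ∕ HC_AV.
-/

namespace Summit.Ventures.HSemireg.DecomposableTwoForms

open ExteriorAlgebra

section Pluecker

variable {K : Type*} [Field K] {n : Type*}

/-- The trivial direction: a decomposable array `a i * b j - a j * b i` satisfies every Plücker relation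
(in any commutative ring). -/
theorem pluecker_of_decomposable {R : Type*} [CommRing R] (a b : n → R) (i j k l : n) :
    (a i * b j - a j * b i) * (a k * b l - a l * b k) - (a i * b k - a k * b i) * (a j * b l - a l * b j)
      + (a i * b l - a l * b i) * (a j * b k - a k * b j) = 0 := by
  ring

/-- **Plücker ⇒ decomposable** over a field: if all the relations
`A i j * A k l - A i k * A j l + A i l * A j k = 0` hold, then `A i j = a i * b j - a j * b i` for two vectors
`a, b` (explicitly: `a = b = 0` if `A = 0`, else `a = A p ·`, `b = A q · / A p q` for any entry `A p q ≠ 0`;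
the relation with indices `p, q, i, j` is the claim).  No alternation hypothesis is needed. -/
theorem decomposable_of_pluecker (A : n → n → K)
    (hP : ∀ i j k l, A i j * A k l - A i k * A j l + A i l * A j k = 0) :
    ∃ a b : n → K, ∀ i j, A i j = a i * b j - a j * b i := by
  by_cases hz : ∀ p q, A p q = 0
  · exact ⟨0, 0, fun i j => by simp [hz]⟩
  push Not at hz
  obtain ⟨p, q, hpq⟩ := hz
  refine ⟨fun j => A p j, fun j => A q j / A p q, fun i j => ?_⟩
  have key := hP p q i j
  rw [show A p i * (A q j / A p q) - A p j * (A q i / A p q) = (A p i * A q j - A p j * A q i) / A p q by ring,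
    eq_div_iff hpq]
  linear_combination key

end Pluecker

section Rank

variable {K : Type*} [Field K] {n : Type*} [Fintype n]

/-- The determinant of an alternating `4 × 4` matrix is the square of its Pfaffian
`S₀₁S₂₃ - S₀₂S₁₃ + S₀₃S₁₂` (any commutative ring). -/
theorem det_eq_pfaffian_sq {R : Type*} [CommRing R] (S : Matrix (Fin 4) (Fin 4) R)
    (h0 : ∀ a, S a a = 0) (hskew : ∀ a b, S b a = -S a b) :
    S.det = (S 0 1 * S 2 3 - S 0 2 * S 1 3 + S 0 3 * S 1 2) ^ 2 := by
  have e10 := hskew 0 1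
  have e20 := hskew 0 2
  have e30 := hskew 0 3
  have e21 := hskew 1 2
  have e31 := hskew 1 3
  have e32 := hskew 2 3
  have d0 := h0 0
  have d1 := h0 1
  have d2 := h0 2
  have d3 := h0 3
  have s2 : (Fin.succ (2 : Fin 3) : Fin 4) = 3 := rfl
  have a00 : (0 : Fin 4).succAbove (0 : Fin 3) = 1 := by decide
  have a01 : (0 : Fin 4).succAbove (1 : Fin 3) = 2 := by decide
  have a02 : (0 : Fin 4).succAbove (2 : Fin 3) = 3 := by decide
  have a10 : (1 : Fin 4).succAbove (0 : Fin 3) = 0 := by decide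
  have a11 : (1 : Fin 4).succAbove (1 : Fin 3) = 2 := by decide
  have a12 : (1 : Fin 4).succAbove (2 : Fin 3) = 3 := by decide
  have a20 : (2 : Fin 4).succAbove (0 : Fin 3) = 0 := by decide
  have a21 : (2 : Fin 4).succAbove (1 : Fin 3) = 1 := by decide
  have a22 : (2 : Fin 4).succAbove (2 : Fin 3) = 3 := by decide
  have a30 : (3 : Fin 4).succAbove (0 : Fin 3) = 0 := by decide
  have a31 : (3 : Fin 4).succAbove (1 : Fin 3) = 1 := by decide
  have a32 : (3 : Fin 4).succAbove (2 : Fin 3) = 2 := by decide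
  have v2 : ((2 : Fin 4) : ℕ) = 2 := rfl
  have v3 : ((3 : Fin 4) : ℕ) = 3 := rfl
  rw [Matrix.det_succ_row_zero]
  simp only [Fin.sum_univ_four, Matrix.det_fin_three, Matrix.submatrix_apply, Fin.succ_zero_eq_one,
    Fin.succ_one_eq_two, s2, a00, a01, a02, a10, a11, a12, a20, a21, a22, a30, a31, a32, Fin.val_zero,
    Fin.val_one, v2, v3, e10, e20, e30, e21, e31, e32, d0, d1, d2, d3]
  ring

/-- **rank `≤ 2` ⇒ Plücker** for an alternating matrix over a field: every `4 × 4` Pfaffian vanishes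
(the `4 × 4` submatrix on rows and columns `i, j, k, l` has rank `≤ 2 < 4`, so its determinant — the square
of the Pfaffian — is zero). -/
theorem pluecker_of_rank_le_two (A : Matrix n n K) (h0 : ∀ i, A i i = 0) (hskew : ∀ i j, A j i = -A i j)
    (hr : A.rank ≤ 2) (i j k l : n) :
    A i j * A k l - A i k * A j l + A i l * A j k = 0 := by
  set f : Fin 4 → n := ![i, j, k, l] with hf
  set S : Matrix (Fin 4) (Fin 4) K := A.submatrix f f with hS
  have hS0 : ∀ a, S a a = 0 := fun a => h0 _
  have hSskew : ∀ a b, S b a = -S a b := fun a b => hskew _ _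
  have hdet : S.det = 0 := by
    by_contra hne
    have hu : IsUnit S := (Matrix.isUnit_iff_isUnit_det S).mpr (isUnit_iff_ne_zero.mpr hne)
    have h4 : S.rank = 4 := by simpa using Matrix.rank_of_isUnit S hu
    have hle : S.rank ≤ A.rank := Matrix.rank_submatrix_le A f f
    omega
  rw [det_eq_pfaffian_sq S hS0 hSskew] at hdet
  have hpf := pow_eq_zero_iff (n := 2) (by norm_num) |>.mp hdet
  simpa [hS, hf, Matrix.submatrix_apply] using hpf

/-- **rank `≤ 2` ⇒ decomposable** for alternating matrices over a field. -/
theorem decomposable_of_rank_le_two (A : Matrix n n K) (h0 : ∀ i, A i i = 0)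
    (hskew : ∀ i j, A j i = -A i j) (hr : A.rank ≤ 2) :
    ∃ a b : n → K, ∀ i j, A i j = a i * b j - a j * b i :=
  decomposable_of_pluecker A (pluecker_of_rank_le_two A h0 hskew hr)

end Rank

section Lift

variable {n : Type*}

/-- **The lift to `ℤ`.**  If the Plücker relations of an integer array hold modulo `2`, then modulo `2` it is
decomposable with INTEGER vectors: `c i j ≡ a i * b j - a j * b i (mod 2)` for some `a, b : n → ℤ`. -/
theorem exists_int_decomposable_mod_two (c : n → n → ℤ)
    (hP : ∀ i j k l, ((c i j * c k l - c i k * c j l + c i l * c j k : ℤ) : ZMod 2) = 0) :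
    ∃ a b : n → ℤ, ∀ i j, (2 : ℤ) ∣ c i j - (a i * b j - a j * b i) := by
  obtain ⟨a, b, hab⟩ := decomposable_of_pluecker (K := ZMod 2) (fun i j => (c i j : ZMod 2))
    (fun i j k l => by have h := hP i j k l; push_cast at h; exact h)
  refine ⟨fun i => ((a i).val : ℤ), fun i => ((b i).val : ℤ), fun i j => ?_⟩
  have h2 : ((c i j - ((a i).val * (b j).val - (a j).val * (b i).val : ℤ) : ℤ) : ZMod 2) = 0 := by
    push_cast
    simp only [ZMod.natCast_val, ZMod.cast_id', id_eq]
    rw [hab i j]; ring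
  have h3 := (ZMod.intCast_zmod_eq_zero_iff_dvd _ 2).mp h2
  rw [Nat.cast_ofNat] at h3
  beta_reduce
  exact h3

end Lift

section Exterior

variable {M : Type*} [AddCommGroup M] [Module ℤ M] {n : Type*} [LinearOrder n] [Fintype n]

/-- Splitting a double sum over a finite linear order into its symmetrised strictly-upper part and its
diagonal. -/
theorem sum_sum_eq_upper_add_diag {A : Type*} [AddCommMonoid A] (t : n → n → A) :
    ∑ i, ∑ j, t i j = (∑ i, ∑ j, if i < j then t i j + t j i else 0) + ∑ i, t i i := by
  have h1 : ∀ i j, t i j =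
      (if i < j then t i j else 0) + (if j < i then t i j else 0) + (if j = i then t i j else 0) := by
    intro i j
    rcases lt_trichotomy i j with h | h | h
    · simp [h, not_lt.mpr h.le, h.ne']
    · subst h; simp
    · simp [h, not_lt.mpr h.le, h.ne]
  have h2 : ∑ i, ∑ j, t i j = (∑ i, ∑ j, if i < j then t i j else 0)
      + (∑ i, ∑ j, if j < i then t i j else 0) + ∑ i, ∑ j, (if j = i then t i j else 0) := by
    simp_rw [← Finset.sum_add_distrib]
    exact Finset.sum_congr rfl fun i _ => Finset.sum_congr rfl fun j _ => h1 i j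
  have h3 : (∑ i, ∑ j, if j < i then t i j else 0) = ∑ i, ∑ j, if i < j then t j i else 0 :=
    Finset.sum_comm
  have h4 : ∀ i : n, (∑ j : n, if j = i then t i j else 0) = t i i := fun i => by
    simp [Finset.sum_ite_eq']
  rw [h2, h3]
  simp_rw [h4]
  congr 1
  rw [← Finset.sum_add_distrib]
  refine Finset.sum_congr rfl fun i _ => ?_
  rw [← Finset.sum_add_distrib]
  refine Finset.sum_congr rfl fun j _ => ?_
  split_ifs <;> simp

omit [LinearOrder n] [Fintype n] in
/-- `ι v · ι u = -(ι u · ι v)`. -/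
theorem ι_mul_ι_swap (u v : M) : ι ℤ v * ι ℤ u = -(ι ℤ u * ι ℤ v) :=
  eq_neg_of_add_eq_zero_right (ι_add_mul_swap u v)

omit [LinearOrder n] in
/-- The coordinate sum of a basis, with the integer scalar action written as `zsmul` (all `ℤ`-module structures on
`M` agree: `Int.cast_smul_eq_zsmul`). -/
theorem basis_sum_repr (x : Module.Basis n ℤ M) (p : M) : (∑ i, x.repr p i • x i) = p := by
  conv_rhs => rw [← x.sum_repr p]
  refine Finset.sum_congr rfl fun i _ => ?_
  rw [← Int.cast_smul_eq_zsmul ℤ, Int.cast_id]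

/-- **The product of two vectors in coordinates.**  For integer coordinate vectors `a, b` on a family `x`,
`ι(Σ aᵢ xᵢ) · ι(Σ bⱼ xⱼ) = Σ_{i<j} (aᵢbⱼ − aⱼbᵢ) · ι xᵢ ι xⱼ` — the decomposable coefficient array. -/
theorem ι_mul_ι_sum (x : n → M) (a b : n → ℤ) :
    ι ℤ (∑ i, a i • x i) * ι ℤ (∑ j, b j • x j)
      = ∑ i, ∑ j, if i < j then ((a i * b j - a j * b i : ℤ) : ExteriorAlgebra ℤ M) * (ι ℤ (x i) * ι ℤ (x j))
          else 0 := by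
  rw [map_sum, map_sum, Finset.sum_mul_sum]
  simp only [map_zsmul, smul_mul_assoc, mul_smul_comm, smul_smul]
  rw [sum_sum_eq_upper_add_diag]
  simp only [ι_sq_zero, smul_zero, Finset.sum_const_zero, add_zero]
  refine Finset.sum_congr rfl fun i _ => Finset.sum_congr rfl fun j _ => ?_
  split_ifs with h
  · rw [ι_mul_ι_swap (x i) (x j), smul_neg, ← sub_eq_add_neg, ← sub_smul, zsmul_eq_mul,
      show b j * a i - b i * a j = a i * b j - a j * b i by ring]
  · rfl

/-- **Decomposable modulo 2 ⇒ `B = ι a · ι b + 2X`.**  If the coefficients `c i j` (`i < j`) of a 2-form on the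
family `x` agree modulo `2` with `a' i * b' j - a' j * b' i`, then the 2-form is `ι a · ι b + 2·X` for the vectors
`a = Σ a' i • x i`, `b = Σ b' i • x i` and some `X` in the `ℤ`-span of the 2-vectors. -/
theorem twoForm_eq_decomposable_add_two_mul (x : n → M) (c : n → n → ℤ) (a' b' : n → ℤ)
    (hc : ∀ i j, i < j → (2 : ℤ) ∣ c i j - (a' i * b' j - a' j * b' i)) :
    ∃ X ∈ Submodule.span ℤ (Set.range fun p : M × M => ι ℤ p.1 * ι ℤ p.2),
      (∑ i, ∑ j, if i < j then (c i j : ExteriorAlgebra ℤ M) * (ι ℤ (x i) * ι ℤ (x j)) else 0)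
        = ι ℤ (∑ i, a' i • x i) * ι ℤ (∑ i, b' i • x i) + 2 * X := by
  have hc' : ∀ i j, ∃ d : ℤ, i < j → c i j = (a' i * b' j - a' j * b' i) + 2 * d := by
    intro i j
    by_cases h : i < j
    · obtain ⟨d, hd⟩ := hc i j h
      exact ⟨d, fun _ => by linarith⟩
    · exact ⟨0, fun h' => absurd h' h⟩
  choose d hd using hc'
  refine ⟨∑ i, ∑ j, if i < j then (d i j : ExteriorAlgebra ℤ M) * (ι ℤ (x i) * ι ℤ (x j)) else 0, ?_, ?_⟩
  · refine Submodule.sum_mem _ fun i _ => Submodule.sum_mem _ fun j _ => ?_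
    split_ifs
    · rw [← zsmul_eq_mul]
      exact Submodule.smul_mem _ _ (Submodule.subset_span ⟨(x i, x j), rfl⟩)
    · exact Submodule.zero_mem _
  · rw [ι_mul_ι_sum, Finset.mul_sum, ← Finset.sum_add_distrib]
    refine Finset.sum_congr rfl fun i _ => ?_
    rw [Finset.mul_sum, ← Finset.sum_add_distrib]
    refine Finset.sum_congr rfl fun j _ => ?_
    split_ifs with h
    · rw [hd i j h, Int.cast_add, add_mul, Int.cast_mul, Int.cast_ofNat, mul_assoc]
    · simp

/-- **Every integral 2-form has an alternating coefficient array in a basis.**  An element of the `ℤ`-span of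
the 2-vectors `ι p · ι q` is `Σ_{i<j} c i j · ι xᵢ ι xⱼ` for an ALTERNATING integer array `c` (`c i i = 0`,
`c j i = −c i j`), `x` any basis indexed by a finite linear order (span induction; a generator `ι p ι q` has the
array `pᵢqⱼ − pⱼqᵢ` of its coordinates by `ι_mul_ι_sum`). -/
theorem exists_coeff_of_mem_span (x : Module.Basis n ℤ M) (X : ExteriorAlgebra ℤ M)
    (hX : X ∈ Submodule.span ℤ (Set.range fun p : M × M => ι ℤ p.1 * ι ℤ p.2)) :
    ∃ c : n → n → ℤ, (∀ i, c i i = 0) ∧ (∀ i j, c j i = -c i j) ∧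
      X = ∑ i, ∑ j, if i < j then (c i j : ExteriorAlgebra ℤ M) * (ι ℤ (x i) * ι ℤ (x j)) else 0 := by
  induction hX using Submodule.span_induction with
  | mem z hz =>
    obtain ⟨⟨p, q⟩, rfl⟩ := hz
    refine ⟨fun i j => x.repr p i * x.repr q j - x.repr p j * x.repr q i, fun i => by ring,
      fun i j => by ring, ?_⟩
    change ι ℤ p * ι ℤ q = _
    rw [← ι_mul_ι_sum x, basis_sum_repr, basis_sum_repr]
  | zero => exact ⟨0, fun _ => rfl, fun _ _ => by simp, by simp⟩
  | add y z _ _ hy hz =>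
    obtain ⟨c, hc0, hcs, rfl⟩ := hy
    obtain ⟨c', hc0', hcs', rfl⟩ := hz
    refine ⟨c + c', fun i => by simp only [Pi.add_apply, hc0, hc0', add_zero],
      fun i j => by simp only [Pi.add_apply]; rw [hcs i j, hcs' i j]; ring, ?_⟩
    rw [← Finset.sum_add_distrib]
    refine Finset.sum_congr rfl fun i _ => ?_
    rw [← Finset.sum_add_distrib]
    refine Finset.sum_congr rfl fun j _ => ?_
    split_ifs
    · rw [Pi.add_apply, Pi.add_apply, Int.cast_add, add_mul]
    · simp
  | smul r y _ hy =>
    obtain ⟨c, hc0, hcs, rfl⟩ := hy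
    refine ⟨fun i j => r * c i j, fun i => by simp [hc0], fun i j => by
      show r * c j i = -(r * c i j); rw [hcs i j]; ring, ?_⟩
    rw [Finset.smul_sum]
    refine Finset.sum_congr rfl fun i _ => ?_
    rw [Finset.smul_sum]
    refine Finset.sum_congr rfl fun j _ => ?_
    rw [smul_ite, smul_zero]
    split_ifs
    · rw [zsmul_eq_mul, Int.cast_mul, mul_assoc]
    · rfl

/-- **S-N-2 AS A THEOREM (Plücker form).**  Let `x : n → M` be any finite family of vectors (a basis of `ℤ¹²`
in the application) and `B = Σ_{i<j} c i j · ι xᵢ ι xⱼ` an integral 2-form whose coefficient array satisfies the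
Plücker relations MODULO 2 (for an alternating `c` these are the `4 × 4` Pfaffians, the coefficients of the
divided square `B^[2]`; so: «`B̄^[2] = 0` over `𝔽₂`»).  Then `B = ι a · ι b + 2·X` for two vectors `a, b ∈ M` and an
`X` in the `ℤ`-span of the 2-vectors — exactly the «leading digit `β = ι a ι b`, ANY integral `X`» hypothesis
shape of `LemmaCFrameClassDead.lemmaC_classDead` ∕ `DimZeroUnitsClassDead.classDead_c222234` ∕
`DimZeroUnitsClassDeadFive.classDead_c222225`. -/
theorem exists_eq_ι_mul_ι_add_two_mul (x : n → M) (c : n → n → ℤ)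
    (hP : ∀ i j k l, ((c i j * c k l - c i k * c j l + c i l * c j k : ℤ) : ZMod 2) = 0) :
    ∃ a b : M, ∃ X ∈ Submodule.span ℤ (Set.range fun p : M × M => ι ℤ p.1 * ι ℤ p.2),
      (∑ i, ∑ j, if i < j then (c i j : ExteriorAlgebra ℤ M) * (ι ℤ (x i) * ι ℤ (x j)) else 0)
        = ι ℤ a * ι ℤ b + 2 * X := by
  obtain ⟨a', b', h⟩ := exists_int_decomposable_mod_two c hP
  obtain ⟨X, hX, e⟩ := twoForm_eq_decomposable_add_two_mul x c a' b' fun i j _ => h i j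
  exact ⟨_, _, X, hX, e⟩

/-- **S-N-2 AS A THEOREM (rank form).**  The same conclusion when the coefficient array, read in `𝔽₂ = ZMod 2`, is
alternating of `Matrix.rank ≤ 2`: «a 2-form of rank `≤ 2` is `ι a · ι b` up to `2Λ²`». -/
theorem exists_eq_ι_mul_ι_add_two_mul_of_rank_le_two (x : n → M) (c : n → n → ℤ)
    (h0 : ∀ i, ((c i i : ℤ) : ZMod 2) = 0) (hskew : ∀ i j, ((c j i : ℤ) : ZMod 2) = -((c i j : ℤ) : ZMod 2))
    (hr : (Matrix.of fun i j => ((c i j : ℤ) : ZMod 2)).rank ≤ 2) :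
    ∃ a b : M, ∃ X ∈ Submodule.span ℤ (Set.range fun p : M × M => ι ℤ p.1 * ι ℤ p.2),
      (∑ i, ∑ j, if i < j then (c i j : ExteriorAlgebra ℤ M) * (ι ℤ (x i) * ι ℤ (x j)) else 0)
        = ι ℤ a * ι ℤ b + 2 * X :=
  exists_eq_ι_mul_ι_add_two_mul x c fun i j k l => by
    have h := pluecker_of_rank_le_two (Matrix.of fun i j => ((c i j : ℤ) : ZMod 2)) h0 hskew hr i j k l
    simp only [Matrix.of_apply] at h
    push_cast
    exact h

/-- **Corollary: the decomposable part of ANY integral 2-form with even divided-square coefficients.**  For `X` in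
the `ℤ`-span of the 2-vectors and a basis `x`, `exists_coeff_of_mem_span` gives its alternating array `c`; if the
`4 × 4` Pfaffians of `c` are even then `X = ι a · ι b + 2·X'`. -/
theorem exists_eq_ι_mul_ι_add_two_mul_of_mem_span (x : Module.Basis n ℤ M) (X : ExteriorAlgebra ℤ M)
    (hX : X ∈ Submodule.span ℤ (Set.range fun p : M × M => ι ℤ p.1 * ι ℤ p.2))
    (hP : ∀ c : n → n → ℤ, (∀ i, c i i = 0) → (∀ i j, c j i = -c i j) →
      X = (∑ i, ∑ j, if i < j then (c i j : ExteriorAlgebra ℤ M) * (ι ℤ (x i) * ι ℤ (x j)) else 0) →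
      ∀ i j k l, (2 : ℤ) ∣ c i j * c k l - c i k * c j l + c i l * c j k) :
    ∃ a b : M, ∃ X' ∈ Submodule.span ℤ (Set.range fun p : M × M => ι ℤ p.1 * ι ℤ p.2),
      X = ι ℤ a * ι ℤ b + 2 * X' := by
  obtain ⟨c, hc0, hcs, rfl⟩ := exists_coeff_of_mem_span x X hX
  exact exists_eq_ι_mul_ι_add_two_mul x c fun i j k l =>
    (ZMod.intCast_zmod_eq_zero_iff_dvd _ 2).mpr (by exact_mod_cast hP c hc0 hcs rfl i j k l)

end Exterior

end Summit.Ventures.HSemireg.DecomposableTwoForms
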